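import Summits.Parity.BatemanHorn.Theorems.SoloInformedWindowEquidistributionBlock
import Summits.Parity.BatemanHorn.Theorems.SoloInformedHooleyProfileFixedScale
import Summits.Parity.BatemanHorn.Theorems.SoloInformedPolynomialGrowth
import Summits.Parity.BatemanHorn.Theorems.SoloInformedRootCountLevel
import Literature.NumberTheory.Sieve.PolynomialCongruencesMeanValues
import HarnessLib

/-!
# Located roots are equidistributed on every bounded window past `x` — unconditionally

[this work]  Let `g ∈ ℤ[X]` be irreducible of degree `≥ 2`, and write (tree objects)

* `W_g(x; y₁, y₂) = polyWindowRootCount g x y₁ y₂ = #{(n, e) : n ≤ x, e ∣ g(n), y₁ < e ≤ y₂}`,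
* `Heur_g(x; y₁, y₂) = polyWindowHeuristic g x y₁ y₂ = x · ∑_{y₁ < e ≤ y₂} ρ_g(e)/e
   = x · (L_g(y₂) − L_g(y₁))`.

The block lemma of `SoloInformedWindowEquidistributionBlock` (Erdős–Turán applied to the located
points with moduli in one block `(E, E'] ⊂ (E, 2E]`, absolute values outside the sum over moduli)
has the summed Hooley sums `∑_{E < e ≤ E'} S_g(d; e)` on its right-hand side; these are `o(E)` at
every fixed scale by HOOLEY's theorem (C. Hooley, *On the distribution of the roots of polynomial
congruences*, Mathematika 11 (1964) 39–49; tree: `hooley_polyRoots_equidistributed_holds`, used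
through `eventually_forall_norm_sum_Ioc_hooleySum_le`).  Chopping a bounded window `(x, T x]`
into `m (T + 1)` blocks of length `⌊x/m⌋ + 1` and letting `m → ∞` slowly gives the main theorem:

* `exists_abs_polyWindowRootCount_sub_heuristic_le` — for every `T` and `η > 0`, for all large
  `x` and all `x ≤ y ≤ T x`:  `|W_g(x; x, y) − Heur_g(x; x, y)| ≤ η · x`.

No mean-value asymptotic for `ρ_g` is used: only the crude bound `∑_{m ≤ y} ρ_g(m) ≤ C y`
(`exists_sum_rootCount_le`); the arc-variation error of a block of length `D` is `≤ (D/x) N`.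
Corollaries:

* `isLittleO_polyWindowRootCount_sub_heuristic` — the `=o[atTop]` form at `y = T x`;
* `exists_abs_polyWindowRootCount_sub_log_le` — `∃ K, ∀ T ≥ 1`, eventually
  `|W_g(x; x, T x) − A_g · x · log T| ≤ K · x` with `K` INDEPENDENT of `T`
  (`A_g = rootLevelConst g`, via `exists_abs_polySmallLevel_sub_log_le`).

Role (Erdős divisor-sum rung, `d ≥ 3`): the located part of `S_g(x) = ∑_{n ≤ x} τ(|g(n)|)` lives
on moduli `x < e < x^{d/2}`; this file makes the FIRST window `(x, T x]` a theorem at every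
bounded scale `T`, unconditionally, in count currency.  Summing `o(x)` over the `≍ log x` dyadic
scales gives `o(x log x)` only if the rate is uniform in the scale — which is precisely the open
located-root hypothesis (`HooleyMeanProfile`-type statements); the present theorem is the
unconditional floor beneath it.
-/

noncomputable section

open Finset Polynomial Filter
open Literature.NumberTheory.Sieve (polyRootCountMod exists_sum_rootCount_le)
open Literature.Analysis.Fourier

namespace Summit.Parity.BatemanHorn.Theorems

/-! ## Main theorem: bounded windows of located moduli are equidistributed -/

/-- **Located roots are equidistributed on bounded windows (unconditional).** [this work]
For `g` irreducible of degree `≥ 2`, every `T : ℕ` and every `η > 0` there is `x₀` such that for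
all `x ≥ x₀` and all `x ≤ y ≤ T x`:
`|W_g(x; x, y) − x (L_g(y) − L_g(x))| ≤ η x`.
Inputs: Hooley 1964 at fixed scales (`eventually_forall_norm_sum_Ioc_hooleySum_le`), Erdős–Turán
(`erdosTuran_finset`) block by block, and `∑_{m ≤ y} ρ_g(m) ≤ C y` (`exists_sum_rootCount_le`). -/
theorem exists_abs_polyWindowRootCount_sub_heuristic_le {g : ℤ[X]} (hirr : Irreducible g)
    (hdeg : 2 ≤ g.natDegree) (T : ℕ) {η : ℝ} (hη : 0 < η) :
    ∃ x₀ : ℕ, ∀ x y : ℕ, x₀ ≤ x → x ≤ y → y ≤ T * x →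
      |(polyWindowRootCount g x x y : ℝ) - polyWindowHeuristic g x x y| ≤ η * x := by
  classical
  have hg0 : ∀ x : ℕ, ∀ n ∈ Icc 1 x, g.eval (n : ℤ) ≠ 0 := fun x n _ =>
    eval_natCast_ne_zero_of_irreducible hirr hdeg n
  obtain ⟨C, hC0, hC⟩ := exists_sum_rootCount_le hirr (by omega)
  -- constants
  obtain ⟨T₁, hT₁0, hTT₁⟩ : ∃ T₁ : ℝ, 0 < T₁ ∧ (T : ℝ) ≤ T₁ := ⟨T + 1, by positivity, by linarith⟩
  obtain ⟨m, hm2, hm⟩ : ∃ m : ℕ, 2 ≤ m ∧ 8 * C * T₁ ≤ η * m := by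
    refine ⟨⌈8 * C * T₁ / η⌉₊ + 2, by omega, ?_⟩
    have h := Nat.le_ceil (8 * C * T₁ / η)
    rw [div_le_iff₀ hη] at h
    push_cast
    nlinarith
  obtain ⟨H, hH1, hHb⟩ : ∃ H : ℕ, 1 ≤ H ∧ 6416 * C * T₁ ≤ η * H := by
    refine ⟨⌈6416 * C * T₁ / η⌉₊ + 1, by omega, ?_⟩
    have h := Nat.le_ceil (6416 * C * T₁ / η)
    rw [div_le_iff₀ hη] at h
    push_cast
    nlinarith
  have hk₀ : 0 < m * (T + 1) := Nat.mul_pos (by omega) (by omega)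
  obtain ⟨ε, hε0, hεeq⟩ :
      ∃ ε : ℝ, 0 < ε ∧ ((m * (T + 1) : ℕ) : ℝ) * (1601 * H * (ε * T₁)) = η / 8 := by
    have hk₀r : (0 : ℝ) < ((m * (T + 1) : ℕ) : ℝ) := by exact_mod_cast hk₀
    have hHr : (0 : ℝ) < H := by exact_mod_cast hH1
    exact ⟨η / (8 * 1601 * ((m * (T + 1) : ℕ) : ℝ) * H * T₁), by positivity,
      by field_simp⟩
  obtain ⟨E₀, hE₀⟩ :=
    eventually_atTop.1 (eventually_forall_norm_sum_Ioc_hooleySum_le hirr hdeg H hε0)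
  -- threshold
  refine ⟨max E₀ (max 2 ⌈8 * C * T₁ / η⌉₊), fun x y hx₀ hxy hyT => ?_⟩
  have hxE₀ : E₀ ≤ x := le_trans (le_max_left _ _) hx₀
  have hx2 : 2 ≤ x := le_trans ((le_max_left _ _).trans (le_max_right _ _)) hx₀
  have hxc : 8 * C * T₁ ≤ η * x := by
    have h := Nat.le_ceil (8 * C * T₁ / η)
    rw [div_le_iff₀ hη] at h
    have h' : (⌈8 * C * T₁ / η⌉₊ : ℝ) ≤ x := by
      exact_mod_cast le_trans ((le_max_right _ _).trans (le_max_right _ _)) hx₀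
    nlinarith
  have hxr : (0 : ℝ) < x := by exact_mod_cast (by omega : 0 < x)
  have hmr : (0 : ℝ) < m := by exact_mod_cast (by omega : 0 < m)
  have hHr : (0 : ℝ) < H := by exact_mod_cast hH1
  have hyT₁ : ∀ y : ℕ, y ≤ T * x → (y : ℝ) ≤ T₁ * x := fun y hy => by
    calc (y : ℝ) ≤ T * x := by exact_mod_cast hy
      _ ≤ T₁ * x := mul_le_mul_of_nonneg_right hTT₁ hxr.le
  -- block length `D = ⌊x/m⌋ + 1`
  obtain ⟨D, hDx, hmD, hDr⟩ : ∃ D : ℕ, D ≤ x ∧ x < m * D ∧ (D : ℝ) ≤ x / m + 1 := by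
    refine ⟨x / m + 1, ?_, Nat.lt_mul_div_succ x (by omega), ?_⟩
    · have : x / m ≤ x / 2 := Nat.div_le_div_left hm2 (by norm_num)
      omega
    · have h : ((x / m : ℕ) : ℝ) ≤ (x : ℝ) / m := Nat.cast_div_le
      push_cast
      linarith
  have hDxr : (D : ℝ) / x ≤ 1 / m + 1 / x :=
    calc (D : ℝ) / x ≤ ((x : ℝ) / m + 1) / x := div_le_div_of_nonneg_right hDr hxr.le
      _ = 1 / m + 1 / x := by rw [add_div, div_right_comm, div_self hxr.ne']
  -- total number of located points in `(x, y]`, `y ≤ T x`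
  have hNle : ∀ y : ℕ, x ≤ y → y ≤ T * x →
      ∑ e ∈ Ioc x y, (polyRootCountMod ![g] e : ℝ) ≤ C * (T₁ * x) := by
    intro y hxy hyT
    have hy2 : (2 : ℝ) ≤ y := by exact_mod_cast hx2.trans hxy
    calc ∑ e ∈ Ioc x y, (polyRootCountMod ![g] e : ℝ)
        ≤ ∑ e ∈ Icc 1 ⌊(y : ℝ)⌋₊, (polyRootCountMod ![g] e : ℝ) := by
          rw [Nat.floor_natCast]
          exact sum_le_sum_of_subset_of_nonneg
            (fun e he => by rw [mem_Ioc] at he; rw [mem_Icc]; omega)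
            fun _ _ _ => Nat.cast_nonneg _
      _ ≤ C * y := hC y hy2
      _ ≤ C * (T₁ * x) := mul_le_mul_of_nonneg_left (hyT₁ y hyT) hC0.le
  -- Hooley on each block inside `(x, T x]`
  have hHoo : ∀ y' y : ℕ, x ≤ y' → y' ≤ y → y ≤ 2 * y' → y ≤ T * x → ∀ d ∈ Icc 1 H,
      ‖∑ e ∈ Ioc y' y, hooleySum g e d‖ ≤ ε * (T₁ * x) := by
    intro y' y hxy' hy'y hy2 hyT d hd
    have h := (hE₀ y' (hxE₀.trans hxy') y hy'y hy2 d hd).1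
    exact h.trans (mul_le_mul_of_nonneg_left (hyT₁ y' (hy'y.trans hyT)) hε0.le)
  have hc : 2 / Real.pi + 1600 ≤ (1601 : ℝ) := by
    have := (div_le_one Real.pi_pos).2 Real.two_le_pi
    linarith
  -- induction over blocks of length `D`
  have key : ∀ k : ℕ, ∀ y : ℕ, x ≤ y → y ≤ x + k * D → y ≤ T * x →
      |(polyWindowRootCount g x x y : ℝ) - polyWindowHeuristic g x x y|
        ≤ ((D : ℝ) / x + 1 / x + 802 / H) * ∑ e ∈ Ioc x y, (polyRootCountMod ![g] e : ℝ)
          + k * (1601 * H * (ε * (T₁ * x))) := by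
    intro k
    induction k with
    | zero =>
      intro y hxy hyk _
      have hyx : y = x := by omega
      rw [hyx, polyWindowRootCount_self, polyWindowHeuristic_self, Ioc_self, sum_empty]
      simp
    | succ k ih =>
      intro y hxy hyk hyT
      by_cases hcase : y ≤ x + k * D
      · refine (ih y hxy hcase hyT).trans ?_
        have hb : (0 : ℝ) ≤ 1601 * H * (ε * (T₁ * x)) := by positivity
        push_cast
        linarith
      · have hlt : x + k * D < y := not_le.1 hcase
        have hsucc : (k + 1) * D = k * D + D := by ring
        have hxy' : x ≤ x + k * D := Nat.le_add_right _ _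
        have hy'y : x + k * D ≤ y := hlt.le
        have hyD : y ≤ x + k * D + D := by omega
        have hy2 : y ≤ 2 * (x + k * D) := by omega
        have hyT' : x + k * D ≤ T * x := hy'y.trans hyT
        have hih := ih (x + k * D) hxy' le_rfl hyT'
        have hblock := abs_polyWindowRootCount_sub_heuristic_le_erdosTuran g (hg0 x) hx2 hxy'
          hy'y hy2 hH1
        -- the Hooley terms of the block
        have hsumH : ∑ d ∈ Icc 1 H, ‖∑ e ∈ Ioc (x + k * D) y, hooleySum g e d‖ / d
            ≤ H * (ε * (T₁ * x)) := by
          calc ∑ d ∈ Icc 1 H, ‖∑ e ∈ Ioc (x + k * D) y, hooleySum g e d‖ / d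
              ≤ ∑ d ∈ Icc 1 H, ε * (T₁ * x) := sum_le_sum fun d hd => by
                have hd1 : (1 : ℝ) ≤ d := by exact_mod_cast (mem_Icc.1 hd).1
                exact (div_le_self (norm_nonneg _) hd1).trans
                  (hHoo _ y hxy' hy'y hy2 hyT d hd)
            _ = H * (ε * (T₁ * x)) := by
                rw [sum_const, Nat.card_Icc, add_tsub_cancel_right, nsmul_eq_mul]
        have hHsum0 : (0 : ℝ) ≤ ∑ d ∈ Icc 1 H, ‖∑ e ∈ Ioc (x + k * D) y, hooleySum g e d‖ / d :=
          sum_nonneg fun d _ => by positivity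
        -- the arc-variation coefficient of the block
        have hy'r : (0 : ℝ) < ((x + k * D : ℕ) : ℝ) := by exact_mod_cast (by omega : 0 < x + k * D)
        have hyr : (0 : ℝ) < y := by exact_mod_cast (by omega : 0 < y)
        have hcoef : (x : ℝ) / ((x + k * D : ℕ) : ℝ) - x / y + 1 / ((x + k * D : ℕ) : ℝ)
            ≤ (D : ℝ) / x + 1 / x := by
          have hxley' : (x : ℝ) ≤ ((x + k * D : ℕ) : ℝ) := by exact_mod_cast hxy'
          have hyy' : (y : ℝ) ≤ ((x + k * D : ℕ) : ℝ) + D := by exact_mod_cast hyD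
          have hy'ley : ((x + k * D : ℕ) : ℝ) ≤ y := by exact_mod_cast hy'y
          have h1 : (x : ℝ) / ((x + k * D : ℕ) : ℝ) - x / y ≤ D / x := by
            rw [div_sub_div _ _ hy'r.ne' hyr.ne', div_le_div_iff₀ (mul_pos hy'r hyr) hxr]
            have hxx : (x : ℝ) * x ≤ ((x + k * D : ℕ) : ℝ) * y :=
              mul_le_mul hxley' (hxley'.trans hy'ley) hxr.le hy'r.le
            have t1 : (x : ℝ) * x * (y - ((x + k * D : ℕ) : ℝ)) ≤ x * x * D :=
              mul_le_mul_of_nonneg_left (by linarith) (mul_nonneg hxr.le hxr.le)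
            have t2 : (x : ℝ) * x * D ≤ ((x + k * D : ℕ) : ℝ) * y * D :=
              mul_le_mul_of_nonneg_right hxx (Nat.cast_nonneg D)
            linarith
          have h2 : (1 : ℝ) / ((x + k * D : ℕ) : ℝ) ≤ 1 / x :=
            div_le_div_of_nonneg_left zero_le_one hxr hxley'
          linarith
        have hN₂0 : (0 : ℝ) ≤ ∑ e ∈ Ioc (x + k * D) y, (polyRootCountMod ![g] e : ℝ) :=
          sum_nonneg fun e _ => Nat.cast_nonneg _
        have hstep : |(polyWindowRootCount g x (x + k * D) y : ℝ)
              - polyWindowHeuristic g x (x + k * D) y|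
            ≤ ((D : ℝ) / x + 1 / x + 802 / H) * ∑ e ∈ Ioc (x + k * D) y,
                (polyRootCountMod ![g] e : ℝ) + 1601 * H * (ε * (T₁ * x)) :=
          hblock.trans (by
            have h802 : 802 * (∑ e ∈ Ioc (x + k * D) y, (polyRootCountMod ![g] e : ℝ)) / H
                = 802 / (H : ℝ) * ∑ e ∈ Ioc (x + k * D) y, (polyRootCountMod ![g] e : ℝ) := by
              ring
            have hb' : (1601 : ℝ) * (H * (ε * (T₁ * x))) = 1601 * H * (ε * (T₁ * x)) := by ring
            linarith [mul_le_mul_of_nonneg_right hcoef hN₂0, mul_le_mul hc hsumH hHsum0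
              (by norm_num), h802, hb'])
        rw [polyWindowRootCount_add g x hxy' hy'y, polyWindowHeuristic_add g x hxy' hy'y,
          ← sum_Ioc_consecutive _ hxy' hy'y]
        push_cast
        calc |((polyWindowRootCount g x x (x + k * D) : ℝ) + polyWindowRootCount g x (x + k * D) y)
              - (polyWindowHeuristic g x x (x + k * D) + polyWindowHeuristic g x (x + k * D) y)|
            = |((polyWindowRootCount g x x (x + k * D) : ℝ)
                  - polyWindowHeuristic g x x (x + k * D))
                + ((polyWindowRootCount g x (x + k * D) y : ℝ)
                  - polyWindowHeuristic g x (x + k * D) y)| := by congr 1; ring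
          _ ≤ |(polyWindowRootCount g x x (x + k * D) : ℝ) - polyWindowHeuristic g x x (x + k * D)|
              + |(polyWindowRootCount g x (x + k * D) y : ℝ)
                  - polyWindowHeuristic g x (x + k * D) y| := abs_add_le _ _
          _ ≤ _ := add_le_add hih hstep
          _ = _ := by push_cast; ring
  -- cover `(x, y]` by `m (T + 1)` blocks and add up
  have hcover : y ≤ x + m * (T + 1) * D := by
    have h2 : T * x ≤ m * (T + 1) * D :=
      calc T * x ≤ (T + 1) * x := Nat.mul_le_mul_right _ (Nat.le_succ _)
        _ ≤ (T + 1) * (m * D) := Nat.mul_le_mul_left _ hmD.le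
        _ = m * (T + 1) * D := by ring
    omega
  refine (key (m * (T + 1)) y hxy hcover hyT).trans ?_
  have hN := hNle y hxy hyT
  have hN0 : (0 : ℝ) ≤ ∑ e ∈ Ioc x y, (polyRootCountMod ![g] e : ℝ) :=
    sum_nonneg fun e _ => Nat.cast_nonneg _
  have h4 : ((m * (T + 1) : ℕ) : ℝ) * (1601 * H * (ε * (T₁ * x))) = η / 8 * x := by
    rw [← hεeq]; ring
  have hmain : ((D : ℝ) / x + 1 / x + 802 / H) * ∑ e ∈ Ioc x y, (polyRootCountMod ![g] e : ℝ)
      ≤ (1 / m + 1 / x + 1 / x + 802 / H) * (C * (T₁ * x)) :=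
    mul_le_mul (by linarith) hN hN0 (by positivity)
  have hsplit : (1 / m + 1 / x + 1 / x + 802 / (H : ℝ)) * (C * (T₁ * x))
      = 1 / (m : ℝ) * (C * (T₁ * x)) + 1 / (x : ℝ) * (C * (T₁ * x))
        + 1 / (x : ℝ) * (C * (T₁ * x)) + 802 / (H : ℝ) * (C * (T₁ * x)) := by ring
  have h5 : 1 / (x : ℝ) * (C * (T₁ * x)) = C * T₁ := by
    rw [show 1 / (x : ℝ) * (C * (T₁ * x)) = C * T₁ * (x / x) by ring, div_self hxr.ne', mul_one]
  have h1 : 1 / (m : ℝ) * (C * (T₁ * x)) ≤ η * x / 8 := by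
    rw [show 1 / (m : ℝ) * (C * (T₁ * x)) = C * T₁ * x / m by ring,
      div_le_div_iff₀ hmr (by norm_num : (0 : ℝ) < 8)]
    linarith [mul_le_mul_of_nonneg_right hm hxr.le]
  have h2 : 802 / (H : ℝ) * (C * (T₁ * x)) ≤ η * x / 8 := by
    rw [show 802 / (H : ℝ) * (C * (T₁ * x)) = 802 * (C * T₁ * x) / H by ring,
      div_le_div_iff₀ hHr (by norm_num : (0 : ℝ) < 8)]
    linarith [mul_le_mul_of_nonneg_right hHb hxr.le]
  have h3 : 2 * (C * T₁) ≤ η * x / 4 := by linarith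
  rw [h4]
  linarith [hmain, hsplit, h1, h2, h3, h5, mul_pos hη hxr]

/-- `=o` form of the main theorem at `y = T x`, `T ≥ 1`. [this work] -/
theorem isLittleO_polyWindowRootCount_sub_heuristic {g : ℤ[X]} (hirr : Irreducible g)
    (hdeg : 2 ≤ g.natDegree) {T : ℕ} (hT : 1 ≤ T) :
    (fun x : ℕ => (polyWindowRootCount g x x (T * x) : ℝ) - polyWindowHeuristic g x x (T * x))
      =o[atTop] fun x : ℕ => (x : ℝ) := by
  refine Asymptotics.isLittleO_iff.2 fun c hc => ?_
  obtain ⟨x₀, hx₀⟩ := exists_abs_polyWindowRootCount_sub_heuristic_le hirr hdeg T hc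
  filter_upwards [eventually_ge_atTop x₀] with x hx
  rw [Real.norm_eq_abs, Real.norm_eq_abs, Nat.abs_cast]
  exact hx₀ x (T * x) hx (Nat.le_mul_of_pos_left x hT) le_rfl

/-- **The first window in count currency.** [this work]  There is `K` (independent of `T`) such
that for every `T ≥ 1`, eventually in `x`:
`|W_g(x; x, T x) − A_g · x · log T| ≤ K · x`, with `A_g = rootLevelConst g`.
From the main theorem (`η = 1`) and `|L_g(y) − A_g log y| ≤ K₀`
(`exists_abs_polySmallLevel_sub_log_le`). -/
theorem exists_abs_polyWindowRootCount_sub_log_le {g : ℤ[X]} (hirr : Irreducible g)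
    (hdeg : 2 ≤ g.natDegree) :
    ∃ K : ℝ, ∀ T : ℕ, 1 ≤ T → ∃ x₀ : ℕ, ∀ x : ℕ, x₀ ≤ x →
      |(polyWindowRootCount g x x (T * x) : ℝ) - rootLevelConst g * x * Real.log T| ≤ K * x := by
  obtain ⟨K₀, hK₀⟩ := exists_abs_polySmallLevel_sub_log_le hirr (by omega)
  refine ⟨2 * K₀ + 1, fun T hT => ?_⟩
  obtain ⟨x₀, hx₀⟩ := exists_abs_polyWindowRootCount_sub_heuristic_le hirr hdeg T one_pos
  refine ⟨max x₀ 1, fun x hx => ?_⟩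
  have hx₀x : x₀ ≤ x := le_trans (le_max_left _ _) hx
  have hx1 : 1 ≤ x := le_trans (le_max_right _ _) hx
  have hT0 : 0 < T := hT
  have hxT : x ≤ T * x := Nat.le_mul_of_pos_left x hT0
  have hTx1 : 1 ≤ T * x := le_trans hx1 hxT
  have hw := hx₀ x (T * x) hx₀x hxT le_rfl
  rw [polyWindowHeuristic_eq_mul_sub g x hxT, one_mul] at hw
  have ha := hK₀ (T * x) hTx1
  have hb := hK₀ x hx1
  have hlog : Real.log ((T * x : ℕ) : ℝ) = Real.log T + Real.log x := by
    push_cast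
    exact Real.log_mul (by exact_mod_cast hT0.ne') (by exact_mod_cast (by omega : x ≠ 0))
  rw [hlog] at ha
  have hxr : (0 : ℝ) ≤ x := Nat.cast_nonneg _
  have key : (polyWindowRootCount g x x (T * x) : ℝ) - rootLevelConst g * x * Real.log T
      = ((polyWindowRootCount g x x (T * x) : ℝ)
          - x * (polySmallLevel g (T * x) - polySmallLevel g x))
        + x * (polySmallLevel g (T * x) - rootLevelConst g * (Real.log T + Real.log x))
        - x * (polySmallLevel g x - rootLevelConst g * Real.log x) := by ring
  rw [key]
  obtain ⟨ha1, ha2⟩ := abs_le.1 ha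
  obtain ⟨hb1, hb2⟩ := abs_le.1 hb
  obtain ⟨hw1, hw2⟩ := abs_le.1 hw
  have e1 := mul_le_mul_of_nonneg_left ha1 hxr
  have e2 := mul_le_mul_of_nonneg_left ha2 hxr
  have e3 := mul_le_mul_of_nonneg_left hb1 hxr
  have e4 := mul_le_mul_of_nonneg_left hb2 hxr
  rw [abs_le]
  constructor <;> linarith

end Summit.Parity.BatemanHorn.Theorems

end
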